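import Summits.HodgeConjecture.HodgeConjecture.Theorems.F0P3cStCharTSSurjHecke        -- ★ p849667 «SURJ-HECKE★» §1–§2 (this seat): `surj_of_shells`; brings ★ p849631 `shf_of_surj_torusTransform`
import Summits.HodgeConjecture.HodgeConjecture.Theorems.F0P3cStCharTSTorusDefs         -- ★ p849564 D1 «TORUS DEFS» (LH6-p01 g2): `torusTransform`, `vanDijkWeight`, `torusChart`, `glDiagonal_torusEntry`
import Summits.HodgeConjecture.HodgeConjecture.Theorems.F0P3cStCharTSWeylHypCM        -- ★ «WEYL-HYP★ (B0)» (LH2-p01 g3): `isUnit_of_ne_zero_of_nonsplit`, `nontrivial_localRing`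
import Summits.HodgeConjecture.HodgeConjecture.Theorems.F0P3cStCharTSVanDijkWeylSymm   -- ★ «VDW-SYMM★» (LH6-p02 g2): `vanDijkWeight_eq_zero_of_not` (re-used, not restated)
import Literature.NumberTheory.Rogawski1990.UnitaryVertexStabilizerSpanCM              -- ★ `classOrbitalIntegral_finset_sum_of_isLocSmooth` (finite additivity at regular classes)
import Literature.NumberTheory.Rogawski1990.RegularEltLocalisation                     -- ★ `isRegularElt_out_mk_local`
import Literature.NumberTheory.Automorphic.LocalUnitaryGroupCongr                      -- ★ `antidiagOne_isHermitian`, `isUnit_antidiagOne_det`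
import Literature.NumberTheory.Automorphic.OrbitalMeasureCanonical                     -- ★ `OrbitalMeasureFamily.IsCanonical.isAdmissibleOn`
import Literature.NumberTheory.Automorphic.UnitaryGroupBorelPair                       -- ★ `glDiagonal_mem_unitaryGroupOfForm_antidiagonal_iff` (torus relations)
import HarnessLib

/-!
# F0 · P3c · line LH6 «StCharTS» — «SURJ-HECKE★» (H2): THE TORUS TRANSFORM `torusTransform` IS ADDITIVE-HOMOGENEOUS ON FINITE SUMS OF SMOOTH TEST FUNCTIONS
# [Rogawski1990, §4.9 p. 54 (orbital integrals); §12.7 L. 12.7.2 (proof) p. 193 (`F_f(m) = Δ(m)Φ(m, f)`)]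

Cell `pub/hodgecm-mathlib`, crux H413 = `stmt-HodgeConjecture-24833` (`--supports` lane, helper), route HCCMUnconditional; seat LH6-p05 (g2); desk F0P3b-plan (g23)
05:49:42Z «SURJ-HECKE★».  THEOREMS ONLY, sorry-free, no definition ∕ instance ∕ notation ∕ named fact.  This file DISCHARGES the binder `hlin` of ★ p849667
`F0P3cStCharTSSurjHecke.surj_of_shells` ∕ `shf_of_shells` at the NAMED transform `torusTransform L v mQv μM` of ★ p849564, for the organ's CANONICAL orbital family
`mQv` (canonical on the regular classes for a Haar measure `νQv`, the (S-a) head's `hcanQ`):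
* §1 `isUnit_sub_three_of_relations`, `isUnit_sub_torusEntry_of_vanDijkWeight_ne_zero` ∕ **`isRegularElt_of_vanDijkWeight_ne_zero`** (with ★ `vanDijkWeight_eq_zero_of_not` of «VDW-SYMM★») — where van Dijk's weight `Δ(t)` (a `dite` on «`d₀⁻¹d₁ − 1`, `d₀⁻¹d₂ − 1`
  units») is non-zero, the torus element `t = d(d₀, d₁, d₂)` is REGULAR: the two unit differences plus the unitary torus relations `σ(d₂)d₀ = 1`, `σ(d₁)d₁ = 1`
  (★ `glDiagonal_mem_unitaryGroupOfForm_antidiagonal_iff`) give `d₁ ≠ d₂` («`d₁ = d₂ ⇔ d₁ = d₀`»), the field-like `E_v` at a non-split `v` (★ `isUnit_of_ne_zero_of_nonsplit`)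
  makes `d₁ − d₂` a unit, and `∏ (X − dᵢ)` is separable.
* §2 **`torusTransform_finset_sum`** — `torusTransform (Σ_{u∈s} c_u·φ_u) = Σ_{u∈s} c_u·torusTransform φ_u` pointwise on `M` for smooth `φ_u` (★
  `classOrbitalIntegral_finset_sum_of_isLocSmooth` + ★ `orbitalIntegral_smul` at the regular class of `ι m` (★ `isRegularElt_out_mk_local`) when `Δ(ι m) ≠ 0`; both sides
  `0` when `Δ(ι m) = 0`) — EXACTLY the `hlin` binder shape of ★ p849667 — and the corollaries **`surj_torusTransform_of_shells`** ∕ **`shf_torusTransform_of_shells`**: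
  (SURJ) ∕ (SHF′) at the named terms modulo ONLY the shell-transform input `hshell` (D3-ii-G for every dominant `u` and level `n`, LH2-p03 (g3)) and the level family
  `C n` (open subgroups `≤ M_c` entering every neighbourhood of `1`).
HONEST LABEL: HC_CM is proved only modulo the 7 printed citations (2 remaining: hLiu418 = stmt-HodgeConjecture-24832, h413 = stmt-HodgeConjecture-24833) until rung 0
closes; count-neutral.

## References
* [Rogawski1990] J. D. Rogawski, *Automorphic Representations of Unitary Groups in Three Variables*, Ann. of Math. Stud. 123 (1990): §4.9 p. 54; §12.5 p. 182; §12.7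
  L. 12.7.2 (proof) p. 193.
* [GetzHahn2024] J. Getz, H. Hahn, *An Introduction to Automorphic Representations*, GTM 300 (2024), Thm. 17.4.1 (orbital integrals at regular semisimple classes).
-/

set_option autoImplicit false
-- the mandated namespace has the single-problem summit's repeated segment (`HodgeConjecture.HodgeConjecture`)
set_option linter.dupNamespace false

noncomputable section

open NumberField IsDedekindDomain MeasureTheory Measure Topology Filter Matrix Polynomial
open scoped NNReal ENNReal Pointwise MatrixGroups
open Literature.NumberTheory.Rogawski1990 Literature.NumberTheory.Automorphic Literature.NumberTheory.Automorphic.UnitaryGroup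

namespace Summit.HodgeConjecture.HodgeConjecture.Cruxes.H413.F0P3cStCharTSSurjHeckeLin

variable (L : Type) [Field L] [NumberField L] [IsCMField L] (v : HeightOneSpectrum (𝓞 ↥(maximalRealSubfield L)))

/-! ## §1 Non-vanishing of van Dijk's weight forces regularity -/

/-- The torus relations on `M ⊂ U(Φ₃)(L⁺_v)`: `σ(d_{2−i})·d_i = 1` for `d_i = torusEntry i t`. [cite: Rogawski1990, §1.10 p. 9; §12.1 p. 171] -/
theorem torusEntry_relation (t : ↥(cmBorelTriple L 3 v).M) (i : Fin 3) :
    conjLocal L (IsCMField.complexConj L) v ((torusEntry (conjLocal L (IsCMField.complexConj L) v) (cmLocalForm L 3 v) (Fin.rev i) t : (LocalRing L v)ˣ) : LocalRing L v) *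
      ((torusEntry (conjLocal L (IsCMField.complexConj L) v) (cmLocalForm L 3 v) i t : (LocalRing L v)ˣ) : LocalRing L v) = 1 := by
  have hd := F0P3cStCharTSTorusDefs.glDiagonal_torusEntry L v t
  have hmem : glDiagonal 3 (LocalRing L v) (fun i => torusEntry (conjLocal L (IsCMField.complexConj L) v) (cmLocalForm L 3 v) i t) ∈
      unitaryGroupOfForm (conjLocal L (IsCMField.complexConj L) v) ((StdForm.antidiagonal 3).over (LocalRing L v)) := by
    rw [hd, ← cmLocalForm_eq_over L 3 v]
    exact (t : ↥(unitaryGroupOfForm (conjLocal L (IsCMField.complexConj L) v) (cmLocalForm L 3 v))).2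
  exact (glDiagonal_mem_unitaryGroupOfForm_antidiagonal_iff (conjLocal L (IsCMField.complexConj L) v) 3 _).1 hmem i

/-- ALGEBRA OF THE UNITARY TORUS: for units `d₀ d₁ d₂` with the `Φ₃`-relations `σ(d₂)d₀ = 1`, `σ(d₁)d₁ = 1`, if `d₀⁻¹d₁ − 1` and `d₀⁻¹d₂ − 1` are units then ALL differences
`dᵢ − dⱼ` (`i ≠ j`) are units, provided non-zero elements are units («`d₁ = d₂ ⇔ d₁ = d₀`»). [cite: Rogawski1990, §1.10 p. 9; §12.5 p. 182] -/
theorem isUnit_sub_three_of_relations {R : Type*} [CommRing R] [Nontrivial R] (σ : R →+* R) (d : Fin 3 → Rˣ)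
    (r0 : σ ((d 2 : Rˣ) : R) * (d 0 : R) = 1) (r1 : σ ((d 1 : Rˣ) : R) * (d 1 : R) = 1)
    (h1 : IsUnit ((((d 0)⁻¹ * d 1 : Rˣ) : R) - 1)) (h2 : IsUnit ((((d 0)⁻¹ * d 2 : Rˣ) : R) - 1))
    (hfield : ∀ x : R, x ≠ 0 → IsUnit x) {i j : Fin 3} (hij : i ≠ j) : IsUnit (((d i : Rˣ) : R) - d j) := by
  -- `d_k − d_0` is a unit when `d_0⁻¹ d_k − 1` is
  have hunit : ∀ k : Fin 3, IsUnit ((((d 0)⁻¹ * d k : Rˣ) : R) - 1) → IsUnit (((d k : Rˣ) : R) - d 0) := by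
    intro k hk
    have heq : ((d k : Rˣ) : R) - d 0 = (d 0 : R) * ((((d 0)⁻¹ * d k : Rˣ) : R) - 1) := by
      rw [Units.val_mul, mul_sub, mul_one, ← mul_assoc, Units.mul_inv, one_mul]
    rw [heq]
    exact (d 0).isUnit.mul hk
  have h10 : IsUnit (((d 1 : Rˣ) : R) - d 0) := hunit 1 h1
  have h20 : IsUnit (((d 2 : Rˣ) : R) - d 0) := hunit 2 h2
  -- `d₁ ≠ d₂` from the torus relations
  have h12 : IsUnit (((d 1 : Rˣ) : R) - d 2) := by
    refine hfield _ (sub_ne_zero.2 fun heq => ?_)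
    rw [← heq] at r0
    have hσu : IsUnit (σ ((d 1 : Rˣ) : R)) := (d 1).isUnit.map σ
    have h01 : (d 0 : R) = d 1 := hσu.mul_left_cancel (r0.trans r1.symm)
    exact h10.ne_zero (by rw [h01, sub_self])
  have hsymm : ∀ {a b : Fin 3}, IsUnit (((d a : Rˣ) : R) - d b) → IsUnit (((d b : Rˣ) : R) - d a) :=
    fun h => by rw [← neg_sub]; exact h.neg
  fin_cases i <;> fin_cases j
  · exact absurd rfl hij
  · exact hsymm h10
  · exact hsymm h20
  · exact h10
  · exact absurd rfl hij
  · exact h12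
  · exact h20
  · exact hsymm h12
  · exact absurd rfl hij

/-- **Where `Δ(t) ≠ 0`, all eigenvalue differences of `t` are units** (non-split `v`): the `dite` of ★ `vanDijkWeight` supplies «`d₀⁻¹d₁ − 1`, `d₀⁻¹d₂ − 1` units»; the
torus relations and the field-like `E_v` (★ `isUnit_of_ne_zero_of_nonsplit`) do the rest. [cite: Rogawski1990, §12.5 p. 182] -/
theorem isUnit_sub_torusEntry_of_vanDijkWeight_ne_zero (hns : ∀ w : PlacesOver L v, IsCMField.complexConj L • w.1 = w.1)
    (t : ↥(cmBorelTriple L 3 v).M) (h : F0P3cStCharTSTorusDefs.vanDijkWeight L v t ≠ 0) {i j : Fin 3} (hij : i ≠ j) :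
    IsUnit (((torusEntry (conjLocal L (IsCMField.complexConj L) v) (cmLocalForm L 3 v) i t : (LocalRing L v)ˣ) : LocalRing L v) -
      ((torusEntry (conjLocal L (IsCMField.complexConj L) v) (cmLocalForm L 3 v) j t : (LocalRing L v)ˣ) : LocalRing L v)) := by
  haveI := F0P3cStCharTSWeylHypCM.nontrivial_localRing L v
  by_cases hc : IsUnit ((((torusEntry (conjLocal L (IsCMField.complexConj L) v) (cmLocalForm L 3 v) 0 t)⁻¹ * torusEntry (conjLocal L (IsCMField.complexConj L) v) (cmLocalForm L 3 v) 1 t : (LocalRing L v)ˣ) : LocalRing L v) - 1) ∧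
      IsUnit ((((torusEntry (conjLocal L (IsCMField.complexConj L) v) (cmLocalForm L 3 v) 0 t)⁻¹ * torusEntry (conjLocal L (IsCMField.complexConj L) v) (cmLocalForm L 3 v) 2 t : (LocalRing L v)ˣ) : LocalRing L v) - 1)
  · have r0 := torusEntry_relation L v t 0
    have r1 := torusEntry_relation L v t 1
    rw [show Fin.rev (0 : Fin 3) = 2 from rfl] at r0
    rw [show Fin.rev (1 : Fin 3) = 1 from rfl] at r1
    exact isUnit_sub_three_of_relations (conjLocal L (IsCMField.complexConj L) v) (fun k => torusEntry (conjLocal L (IsCMField.complexConj L) v) (cmLocalForm L 3 v) k t) r0 r1 hc.1 hc.2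
      (F0P3cStCharTSWeylHypCM.isUnit_of_ne_zero_of_nonsplit L v hns) hij
  · exact absurd (F0P3cStCharTSVanDijkWeylSymm.vanDijkWeight_eq_zero_of_not L v t hc) h

/-- **`Δ(t) ≠ 0 ⇒ t` is REGULAR** (`IsRegularElt`: separable characteristic polynomial `∏ (X − dᵢ)`). Non-split `v`. [cite: Rogawski1990, §12.5 p. 182] -/
theorem isRegularElt_of_vanDijkWeight_ne_zero (hns : ∀ w : PlacesOver L v, IsCMField.complexConj L • w.1 = w.1)
    (t : ↥(cmBorelTriple L 3 v).M) (h : F0P3cStCharTSTorusDefs.vanDijkWeight L v t ≠ 0) :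
    IsRegularElt ((((t : ↥(unitaryGroupOfForm (conjLocal L (IsCMField.complexConj L) v) (cmLocalForm L 3 v))) : Gqs L v).val : GL (Fin 3) (LocalRing L v))) := by
  have hd := F0P3cStCharTSTorusDefs.glDiagonal_torusEntry L v t
  show IsRegularElt (((t : ↥(unitaryGroupOfForm (conjLocal L (IsCMField.complexConj L) v) (cmLocalForm L 3 v))) : GL (Fin 3) (LocalRing L v)))
  rw [← hd, IsRegularElt, coe_glDiagonal, Matrix.charpoly_diagonal]
  exact separable_prod (fun i j hij => isCoprime_X_sub_C_of_isUnit_sub (isUnit_sub_torusEntry_of_vanDijkWeight_ne_zero L v hns t h hij))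
    fun _ => separable_X_sub_C

/-! ## §2 `torusTransform` is additive-homogeneous on finite sums of smooth functions (the `hlin` binder of ★ p849667) -/

/-- **`F_{Σ c_u φ_u} = Σ c_u F_{φ_u}` on `M`** for smooth `φ_u` and the canonical family `mQv`: at `m` with `Δ(ι m) = 0` both sides vanish; otherwise `ι m` is regular (§1),
so is the class representative (★ `isRegularElt_out_mk_local`), and ★ `classOrbitalIntegral_finset_sum_of_isLocSmooth` + ★ `orbitalIntegral_smul` apply (canonical ⇒
admissible, ★ `IsCanonical.isAdmissibleOn`).  This is EXACTLY the `hlin` binder of ★ `F0P3cStCharTSSurjHecke.surj_of_shells`. [cite: Rogawski1990, §4.9 p. 54; §12.7 L. 12.7.2 (proof) p. 193] -/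
theorem torusTransform_finset_sum (hns : ∀ w : PlacesOver L v, IsCMField.complexConj L • w.1 = w.1)
    [MeasurableSpace (Gqs L v)] [BorelSpace (Gqs L v)]
    [∀ γ : Gqs L v, MeasurableSpace (Gqs L v ⧸ Subgroup.centralizer ({γ} : Set (Gqs L v)))]
    [∀ γ : Gqs L v, BorelSpace (Gqs L v ⧸ Subgroup.centralizer ({γ} : Set (Gqs L v)))]
    (νQv : Measure (Gqs L v)) [νQv.IsHaarMeasure] [νQv.IsMulRightInvariant]
    {mQv : OrbitalMeasureFamily (Gqs L v)} (hcanQ : mQv.IsCanonical (fun γ => IsRegularElt (γ.val : GL (Fin 3) (UnitaryGroup.LocalRing L v))) νQv)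
    [MeasurableSpace ((UnitaryGroup.LocalRing L v)ˣ × ↥(normOneUnits (conjLocal L (IsCMField.complexConj L) v)))] (μM : Measure ((UnitaryGroup.LocalRing L v)ˣ × ↥(normOneUnits (conjLocal L (IsCMField.complexConj L) v))))
    (s : Finset ((UnitaryGroup.LocalRing L v)ˣ × ↥(normOneUnits (conjLocal L (IsCMField.complexConj L) v)))) (c : ((UnitaryGroup.LocalRing L v)ˣ × ↥(normOneUnits (conjLocal L (IsCMField.complexConj L) v))) → ℂ) (φ : ((UnitaryGroup.LocalRing L v)ˣ × ↥(normOneUnits (conjLocal L (IsCMField.complexConj L) v))) → Gqs L v → ℂ) (hφ : ∀ u ∈ s, IsLocSmooth (φ u)) :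
    F0P3cStCharTSTorusDefs.torusTransform L v mQv μM (fun x => ∑ u ∈ s, c u * φ u x) =
      fun m => ∑ u ∈ s, c u * F0P3cStCharTSTorusDefs.torusTransform L v mQv μM (φ u) m := by
  funext m
  simp only [F0P3cStCharTSTorusDefs.torusTransform]
  by_cases hW : F0P3cStCharTSTorusDefs.vanDijkWeight L v (F0P3cStCharTSTorusDefs.torusChart L v m) = 0
  · simp only [hW, zero_mul, mul_zero, Finset.sum_const_zero]
  · have hreg := isRegularElt_of_vanDijkWeight_ne_zero L v hns _ hW
    have hadm : mQv.IsAdmissibleOn (fun γ => IsRegularElt (γ.val : GL (Fin 3) (UnitaryGroup.LocalRing L v))) := hcanQ.isAdmissibleOn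
    rw [show (fun x => ∑ u ∈ s, c u * φ u x) = fun x => ∑ u ∈ s, (fun u' x' => c u' * φ u' x') u x from rfl,
      classOrbitalIntegral_finset_sum_of_isLocSmooth L (qsForm L) v (antidiagOne_isHermitian L 3) (isUnit_antidiagOne_det L 3).ne_zero hadm _
        (isRegularElt_out_mk_local hreg) s _ (fun u hu => F0P3cStCharTSSurjHecke.isLocSmooth_const_mul (c u) (hφ u hu))]
    rw [Finset.mul_sum, Finset.mul_sum]
    refine Finset.sum_congr rfl fun u _ => ?_
    rw [classOrbitalIntegral_eq, classOrbitalIntegral_eq, show (fun x' => c u * φ u x') = c u • φ u from rfl, orbitalIntegral_smul, smul_eq_mul]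
    ring

/-- **(SURJ) FOR `torusTransform` ∕ `hyperbolicSet` MODULO THE SHELL TRANSFORMS** — ★ p849667 `surj_of_shells` with `hlin` discharged by §2.
[cite: Rogawski1990, §12.7 L. 12.7.1 (proof) p. 191; L. 12.7.2 (proof) p. 194] -/
theorem surj_torusTransform_of_shells (hns : ∀ w : PlacesOver L v, IsCMField.complexConj L • w.1 = w.1)
    [MeasurableSpace (Gqs L v)] [BorelSpace (Gqs L v)]
    [∀ γ : Gqs L v, MeasurableSpace (Gqs L v ⧸ Subgroup.centralizer ({γ} : Set (Gqs L v)))]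
    [∀ γ : Gqs L v, BorelSpace (Gqs L v ⧸ Subgroup.centralizer ({γ} : Set (Gqs L v)))]
    (νQv : Measure (Gqs L v)) [νQv.IsHaarMeasure] [νQv.IsMulRightInvariant]
    {mQv : OrbitalMeasureFamily (Gqs L v)} (hcanQ : mQv.IsCanonical (fun γ => IsRegularElt (γ.val : GL (Fin 3) (UnitaryGroup.LocalRing L v))) νQv)
    [MeasurableSpace ((UnitaryGroup.LocalRing L v)ˣ × ↥(normOneUnits (conjLocal L (IsCMField.complexConj L) v)))] (μM : Measure ((UnitaryGroup.LocalRing L v)ˣ × ↥(normOneUnits (conjLocal L (IsCMField.complexConj L) v))))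
    (C : ℕ → Subgroup ((UnitaryGroup.LocalRing L v)ˣ × ↥(normOneUnits (conjLocal L (IsCMField.complexConj L) v)))) (hCo : ∀ n, IsOpen (C n : Set ((UnitaryGroup.LocalRing L v)ˣ × ↥(normOneUnits (conjLocal L (IsCMField.complexConj L) v)))))
    (hCle : ∀ n, C n ≤ (((Submonoid.pi Set.univ (fun w : PlacesOver L v => (w.1.adicCompletionIntegers L).toSubring.toSubmonoid)).units.prod (⊤ : Subgroup ↥(normOneUnits (conjLocal L (IsCMField.complexConj L) v)))) : Subgroup ((UnitaryGroup.LocalRing L v)ˣ × ↥(normOneUnits (conjLocal L (IsCMField.complexConj L) v))))) (hCb : ∀ V ∈ 𝓝 (1 : ((UnitaryGroup.LocalRing L v)ˣ × ↥(normOneUnits (conjLocal L (IsCMField.complexConj L) v)))), ∃ n, (C n : Set ((UnitaryGroup.LocalRing L v)ˣ × ↥(normOneUnits (conjLocal L (IsCMField.complexConj L) v)))) ⊆ V)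
    (hshell : ∀ (n : ℕ) (u : ((UnitaryGroup.LocalRing L v)ˣ × ↥(normOneUnits (conjLocal L (IsCMField.complexConj L) v)))), (∀ w : PlacesOver L v, Valued.v ((u.1 : UnitaryGroup.LocalRing L v) w) < 1) →
      ∃ φ : Gqs L v → ℂ, IsLocSmooth φ ∧ tsupport φ ⊆ F0P3cStCharTSTorusDefs.hyperbolicSet L v ∧ ∃ κ : ℂ, κ ≠ 0 ∧
        F0P3cStCharTSTorusDefs.torusTransform L v mQv μM φ =
          fun m => κ * ((u • (C n : Set ((UnitaryGroup.LocalRing L v)ˣ × ↥(normOneUnits (conjLocal L (IsCMField.complexConj L) v))))).indicator (fun _ => (1 : ℂ)) m + (u • (C n : Set ((UnitaryGroup.LocalRing L v)ˣ × ↥(normOneUnits (conjLocal L (IsCMField.complexConj L) v))))).indicator (fun _ => (1 : ℂ)) ((fun p : ((UnitaryGroup.LocalRing L v)ˣ × ↥(normOneUnits (conjLocal L (IsCMField.complexConj L) v))) => ((Units.map ((conjLocal L (IsCMField.complexConj L) v : UnitaryGroup.LocalRing L v →+* UnitaryGroup.LocalRing L v) : UnitaryGroup.LocalRing L v →* UnitaryGroup.LocalRing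 L v) p.1)⁻¹, p.2)) m))) :
    ∀ F : ((UnitaryGroup.LocalRing L v)ˣ × ↥(normOneUnits (conjLocal L (IsCMField.complexConj L) v))) → ℂ, IsLocSmooth F → (∀ m : ((UnitaryGroup.LocalRing L v)ˣ × ↥(normOneUnits (conjLocal L (IsCMField.complexConj L) v))), F ((fun p : ((UnitaryGroup.LocalRing L v)ˣ × ↥(normOneUnits (conjLocal L (IsCMField.complexConj L) v))) => ((Units.map ((conjLocal L (IsCMField.complexConj L) v : UnitaryGroup.LocalRing L v →+* UnitaryGroup.LocalRing L v) : UnitaryGroup.LocalRing L v →* UnitaryGroup.LocalRing L v) p.1)⁻¹, p.2)) m) = F m) → (∀ m ∈ (((Submonoid.pi Set.univ (fun w : PlacesOver L v => (w.1.adicCompletionIntegers L).toSubring.toSubmonoid)).units.prod (⊤ : Subgroup ↥(normOneUnits (conjLocal L (IsCMField.complexConj L) v)))) : Subgroup ((UnitaryGroup.LocalRing L v)ˣ × ↥(normOneUnits (conjLocal L (IsCMField.complexConj L) v)))), F m = 0) →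
      ∃ φ : Gqs L v → ℂ, (IsLocSmooth φ ∧ tsupport φ ⊆ F0P3cStCharTSTorusDefs.hyperbolicSet L v) ∧ F0P3cStCharTSTorusDefs.torusTransform L v mQv μM φ = F :=
  F0P3cStCharTSSurjHecke.surj_of_shells L v hns (F0P3cStCharTSTorusDefs.torusTransform L v mQv μM) (F0P3cStCharTSTorusDefs.hyperbolicSet L v) C hCo hCle hCb hshell
    (torusTransform_finset_sum L v hns νQv hcanQ μM)

/-- **(SHF′) AT THE NAMED TERMS MODULO THE SHELL TRANSFORMS**: (SURJ) above + ★ p849631 `shf_of_surj_torusTransform` — the (SHF′) conjunct of ★ p849458 with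
`Ftr := torusTransform L v mQv μM`, `Ω := hyperbolicSet L v`, `toC := pairChar L v`. [cite: Rogawski1990, §12.7 L. 12.7.1 (proof) p. 191; L. 12.7.2 (proof) pp. 193–194] -/
theorem shf_torusTransform_of_shells (hns : ∀ w : PlacesOver L v, IsCMField.complexConj L • w.1 = w.1)
    [MeasurableSpace (Gqs L v)] [BorelSpace (Gqs L v)]
    [∀ γ : Gqs L v, MeasurableSpace (Gqs L v ⧸ Subgroup.centralizer ({γ} : Set (Gqs L v)))]
    [∀ γ : Gqs L v, BorelSpace (Gqs L v ⧸ Subgroup.centralizer ({γ} : Set (Gqs L v)))]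
    (νQv : Measure (Gqs L v)) [νQv.IsHaarMeasure] [νQv.IsMulRightInvariant]
    {mQv : OrbitalMeasureFamily (Gqs L v)} (hcanQ : mQv.IsCanonical (fun γ => IsRegularElt (γ.val : GL (Fin 3) (UnitaryGroup.LocalRing L v))) νQv)
    [MeasurableSpace ((UnitaryGroup.LocalRing L v)ˣ × ↥(normOneUnits (conjLocal L (IsCMField.complexConj L) v)))] (μM : Measure ((UnitaryGroup.LocalRing L v)ˣ × ↥(normOneUnits (conjLocal L (IsCMField.complexConj L) v))))
    (C : ℕ → Subgroup ((UnitaryGroup.LocalRing L v)ˣ × ↥(normOneUnits (conjLocal L (IsCMField.complexConj L) v)))) (hCo : ∀ n, IsOpen (C n : Set ((UnitaryGroup.LocalRing L v)ˣ × ↥(normOneUnits (conjLocal L (IsCMField.complexConj L) v)))))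
    (hCle : ∀ n, C n ≤ (((Submonoid.pi Set.univ (fun w : PlacesOver L v => (w.1.adicCompletionIntegers L).toSubring.toSubmonoid)).units.prod (⊤ : Subgroup ↥(normOneUnits (conjLocal L (IsCMField.complexConj L) v)))) : Subgroup ((UnitaryGroup.LocalRing L v)ˣ × ↥(normOneUnits (conjLocal L (IsCMField.complexConj L) v))))) (hCb : ∀ V ∈ 𝓝 (1 : ((UnitaryGroup.LocalRing L v)ˣ × ↥(normOneUnits (conjLocal L (IsCMField.complexConj L) v)))), ∃ n, (C n : Set ((UnitaryGroup.LocalRing L v)ˣ × ↥(normOneUnits (conjLocal L (IsCMField.complexConj L) v)))) ⊆ V)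
    (hshell : ∀ (n : ℕ) (u : ((UnitaryGroup.LocalRing L v)ˣ × ↥(normOneUnits (conjLocal L (IsCMField.complexConj L) v)))), (∀ w : PlacesOver L v, Valued.v ((u.1 : UnitaryGroup.LocalRing L v) w) < 1) →
      ∃ φ : Gqs L v → ℂ, IsLocSmooth φ ∧ tsupport φ ⊆ F0P3cStCharTSTorusDefs.hyperbolicSet L v ∧ ∃ κ : ℂ, κ ≠ 0 ∧
        F0P3cStCharTSTorusDefs.torusTransform L v mQv μM φ =
          fun m => κ * ((u • (C n : Set ((UnitaryGroup.LocalRing L v)ˣ × ↥(normOneUnits (conjLocal L (IsCMField.complexConj L) v))))).indicator (fun _ => (1 : ℂ)) m + (u • (C n : Set ((UnitaryGroup.LocalRing L v)ˣ × ↥(normOneUnits (conjLocal L (IsCMField.complexConj L) v))))).indicator (fun _ => (1 : ℂ)) ((fun p : ((UnitaryGroup.LocalRing L v)ˣ × ↥(normOneUnits (conjLocal L (IsCMField.complexConj L) v))) => ((Units.map ((conjLocal L (IsCMField.complexConj L) v : UnitaryGroup.LocalRing L v →+* UnitaryGroup.LocalRing L v) : UnitaryGroup.LocalRing L v →* UnitaryGroup.LocalRing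 L v) p.1)⁻¹, p.2)) m))) :
    (∀ χ : (((UnitaryGroup.LocalRing L v)ˣ →* ℂˣ) × (↥(normOneUnits (conjLocal L (IsCMField.complexConj L) v)) →* ℂˣ)), Continuous χ.1 → Continuous χ.2 → ∀ (j : Bool) (m₀ : ((UnitaryGroup.LocalRing L v)ˣ × ↥(normOneUnits (conjLocal L (IsCMField.complexConj L) v)))), m₀ ∉ ((Submonoid.pi Set.univ (fun w : PlacesOver L v => (w.1.adicCompletionIntegers L).toSubring.toSubmonoid)).units.prod (⊤ : Subgroup ↥(normOneUnits (conjLocal L (IsCMField.complexConj L) v)))) → ∃ φ : Gqs L v → ℂ, (IsLocSmooth φ ∧ tsupport φ ⊆ F0P3cStCharTSTorusDefs.hyperbolicSet L v) ∧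
            F0P3cStCharTSTorusDefs.torusTransform L v mQv μM φ = fun m => ((m₀ • ((((Submonoid.pi Set.univ (fun w : PlacesOver L v => (w.1.adicCompletionIntegers L).toSubring.toSubmonoid)).units.prod (⊤ : Subgroup ↥(normOneUnits (conjLocal L (IsCMField.complexConj L) v)))) : Subgroup ((UnitaryGroup.LocalRing L v)ˣ × ↥(normOneUnits (conjLocal L (IsCMField.complexConj L) v)))) : Set ((UnitaryGroup.LocalRing L v)ˣ × ↥(normOneUnits (conjLocal L (IsCMField.complexConj L) v))))).indicator (fun m => (((F0P3cStCharTSTorusDefs.pairChar L v (cond j (conjInvChar (conjLocal L (IsCMField.complexConj L) v) χ.1, χ.2) χ)) m₀ : ℂˣ) : ℂ) * ((((F0P3cStCharTSTorusDefs.pairChar L v (cond j (conjInvChar (conjLocal L (IsCMField.complexConj L) v) χ.1, χ.2) χ)) m)⁻¹ : ℂˣ) : ℂ)) m) + ((m₀ • ((((Submonoid.pi Set.univ (fun w : PlacesOver L v => (w.1.adicCompletionIntegers L).toSubring.toSubmonoid)).units.prod (⊤ : Subgroup ↥(normOneUnits (conjLocal L (IsCMField.complexConj L) v)))) : Subgroup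 ((UnitaryGroup.LocalRing L v)ˣ × ↥(normOneUnits (conjLocal L (IsCMField.complexConj L) v)))) : Set ((UnitaryGroup.LocalRing L v)ˣ × ↥(normOneUnits (conjLocal L (IsCMField.complexConj L) v))))).indicator (fun m => (((F0P3cStCharTSTorusDefs.pairChar L v (cond j (conjInvChar (conjLocal L (IsCMField.complexConj L) v) χ.1, χ.2) χ)) m₀ : ℂˣ) : ℂ) * ((((F0P3cStCharTSTorusDefs.pairChar L v (cond j (conjInvChar (conjLocal L (IsCMField.complexConj L) v) χ.1, χ.2) χ)) m)⁻¹ : ℂˣ) : ℂ)) ((Units.map ((conjLocal L (IsCMField.complexConj L) v : UnitaryGroup.LocalRing L v →+* UnitaryGroup.LocalRing L v) : UnitaryGroup.LocalRing L v →* UnitaryGroup.LocalRing L v) m.1)⁻¹, m.2))) :=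
  F0P3cStCharTSShfOfSurj.shf_of_surj_torusTransform L v hns mQv μM
    (surj_torusTransform_of_shells L v hns νQv hcanQ μM C hCo hCle hCb hshell)

end Summit.HodgeConjecture.HodgeConjecture.Cruxes.H413.F0P3cStCharTSSurjHeckeLin

end
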